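import Mathlib
import Literature.AlgebraicGeometry.Resolution.CobordantArcLemma

/-!
# Arc persistence, and: weighted point blow-ups alone cannot win the local game

Continuation of `CobordantArcLemma.lean` (cdisprove refuter for the crux `LocalWeightedDrop`,
stmt-ResolutionOfSingularities-8899).

* `arc_persists` — under the hypotheses of `CobordantArc.singular_of_arc` the lifted arc lies in
  the singular locus of the successor `g` (`g(Λ) = 0`, `∂_J g(Λ) = 0`);
* `ArcSingular f` — the refuter's invariant class: non-zero singular germs carrying a non-zero arc
  of the singular locus; `arcSingular_node_cylinder` (`x₀x₁ ⊂ 𝔸³`);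
* `arcSingular_successor` — CLOSURE: every move with ALL WEIGHTS POSITIVE (weighted blow-up of
  the origin after an arbitrary formal coordinate change `θ`) from a germ of the class has an
  exceptional point off the vertex and a factorised successor `g`, `s ∤ g`, again in the class
  (formal IFT to transport the arc, `exists_arc_lift`, `singular_of_arc`, `arc_persists`);
* `pointCentres_game_lost` — hence over EVERY field there is NO rank function for the game of
  `LocalWeightedDrop` restricted to all-positive weights: the natural strengthening
  "weighted POINT blow-ups suffice" of the crux is FALSE.  Any winning strategy must use
  positive-dimensional centres (`wᵢ = 0` for some `i`) — the cobordant blow-ups of smooth centres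
  of positive dimension, exactly as in Abramovich–Temkin–Włodarczyk / Włodarczyk's algorithms;
* `centre_contains_singular_arcs_of_oneMoveWin` — the one-move form of the same message: a move
  that leaves no singular successor off the vertex must have a centre containing (the
  `θ⁻¹`-image of) every arc of the singular locus.
-/

namespace Literature.AlgebraicGeometry.Resolution.CobordantArc

open MvPowerSeries Literature.RingTheory.MvPowerSeries

/-! ### Persistence of the lifted arc inside the singular locus of the successor -/

section Persistence

variable {k : Type*} [Field k] {n : ℕ}

/-- PERSISTENCE.  Under the hypotheses of `singular_of_arc`, the lifted arc `Λ` lies in the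
singular locus of the successor: `g(Λ) = 0` and `∂_J g(Λ) = 0` for all `J`. [folklore] -/
theorem arc_persists {F g : MvPowerSeries (Fin (n + 1)) k} {a : ℕ}
    (hfac : F = MvPowerSeries.X 0 ^ a * g) (Λ : Fin (n + 1) → PowerSeries k)
    (hΛ : ∀ J, MvPowerSeries.constantCoeff (Λ J) = 0) (hs : Λ 0 ≠ 0)
    (h0 : MvPowerSeries.subst Λ F = 0) (h1 : ∀ J, MvPowerSeries.subst Λ (pd J F) = 0) :
    MvPowerSeries.subst Λ g = 0 ∧ ∀ J, MvPowerSeries.subst Λ (pd J g) = 0 := by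
  classical
  have has := MvPowerSeries.hasSubst_of_constantCoeff_zero hΛ
  have hsa : (Λ 0) ^ a ≠ 0 := pow_ne_zero _ hs
  have hg : MvPowerSeries.subst Λ g = 0 := by
    rw [hfac, MvPowerSeries.subst_mul has, MvPowerSeries.subst_pow has, MvPowerSeries.subst_X has] at h0
    rcases mul_eq_zero.mp h0 with h | h
    · exact absurd h hsa
    · exact h
  refine ⟨hg, fun J => ?_⟩
  have hJ := h1 J
  rw [hfac, pd_mul] at hJ
  have hJ' : MvPowerSeries.subst Λ ((pd J (MvPowerSeries.X 0 ^ a) * MvPowerSeries.X 0) * g +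
      MvPowerSeries.X 0 ^ (a + 1) * pd J g) = 0 := by
    have : (pd J (MvPowerSeries.X 0 ^ a) * MvPowerSeries.X 0) * g + MvPowerSeries.X 0 ^ (a + 1) * pd J g =
        MvPowerSeries.X 0 * (pd J (MvPowerSeries.X 0 ^ a) * g + MvPowerSeries.X 0 ^ a * pd J g) := by ring
    rw [this, MvPowerSeries.subst_mul has, hJ, mul_zero]
  rw [pd_X_zero_pow] at hJ'
  rw [MvPowerSeries.subst_add has, MvPowerSeries.subst_mul has, MvPowerSeries.subst_mul has,
    hg, mul_zero, zero_add] at hJ'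
  rw [MvPowerSeries.subst_mul has, MvPowerSeries.subst_pow has, MvPowerSeries.subst_X has] at hJ'
  rcases mul_eq_zero.mp hJ' with h | h
  · exact absurd h (pow_ne_zero _ hs)
  · exact h

end Persistence


/-! ### Weighted POINT blow-ups alone cannot win -/

section PointCentres

open Literature.AlgebraicGeometry.Resolution.CobordantChart
  Literature.AlgebraicGeometry.Resolution.FormalCoordChange
  Literature.AlgebraicGeometry.Resolution

variable {k : Type*} [Field k]

/-- The literal chart family of the crux equals `chart w c` under the convention. [folklore] -/
theorem cruxChart_eq_chart_of_convention {n : ℕ} (w : Fin n → ℕ) (c : Fin n → k)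
    (hc : ∀ i, w i = 0 → c i = 0) :
    (fun i : Fin n => if 0 < w i then
        MvPowerSeries.X (0 : Fin (n + 1)) ^ (w i) * (MvPowerSeries.C (c i) + MvPowerSeries.X i.succ)
        else (MvPowerSeries.X i.succ : MvPowerSeries (Fin (n + 1)) k)) = chart w c := by
  rw [cruxChart_eq_chart]
  congr 1
  funext i
  split_ifs with h
  · rfl
  · exact (hc i (by omega)).symm

/-- The refuter's invariant class: non-zero singular germs carrying a non-zero arc of the
singular locus through the origin. [folklore] -/
def ArcSingular {n : ℕ} (f : MvPowerSeries (Fin n) k) : Prop :=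
  f ≠ 0 ∧ (MvPowerSeries.constantCoeff f = 0 ∧ ∀ i, MvPowerSeries.coeff (Finsupp.single i 1) f = 0) ∧
    ∃ Γ : Fin n → PowerSeries k, (∀ i, PowerSeries.constantCoeff (Γ i) = 0) ∧ (∃ i, Γ i ≠ 0) ∧
      (MvPowerSeries.subst Γ f : PowerSeries k) = 0 ∧ ∀ m, (MvPowerSeries.subst Γ (pd m f) : PowerSeries k) = 0

/-- The node cylinder `x₀x₁ ⊂ 𝔸³` with its singular line `t ↦ (0,0,t)` is in the class. [folklore] -/
theorem arcSingular_node_cylinder : ArcSingular (MvPowerSeries.X 0 * MvPowerSeries.X 1 : MvPowerSeries (Fin 3) k) := by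
  classical
  have hasγ : MvPowerSeries.HasSubst (coordArc (k := k) 2) :=
    MvPowerSeries.hasSubst_of_constantCoeff_zero (constantCoeff_coordArc 2)
  refine ⟨mul_ne_zero (Literature.AlgebraicGeometry.Resolution.FormalCoordChange.X_ne_zero' 0)
      (Literature.AlgebraicGeometry.Resolution.FormalCoordChange.X_ne_zero' 1), ?_,
    coordArc 2, constantCoeff_coordArc 2, ⟨2, by rw [coordArc_apply_self]; exact PowerSeries.X_ne_zero⟩, ?_, ?_⟩
  · rw [← two_le_order_iff]
    calc (2 : ℕ∞) = 1 + 1 := by norm_num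
      _ ≤ (MvPowerSeries.X (0 : Fin 3) : MvPowerSeries (Fin 3) k).order + (MvPowerSeries.X (1 : Fin 3)).order :=
          add_le_add (MvPowerSeries.one_le_order_iff_constCoeff_eq_zero.mpr (MvPowerSeries.constantCoeff_X 0))
            (MvPowerSeries.one_le_order_iff_constCoeff_eq_zero.mpr (MvPowerSeries.constantCoeff_X 1))
      _ ≤ _ := MvPowerSeries.le_order_mul
  · rw [MvPowerSeries.subst_mul hasγ, MvPowerSeries.subst_X hasγ, coordArc_apply_ne (by decide), zero_mul]
  · intro m
    rw [pd_mul, pd_X, pd_X, ← MvPowerSeries.coe_substAlgHom hasγ]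
    simp only [map_add, map_mul, MvPowerSeries.substAlgHom_X]
    rw [coordArc_apply_ne (show (0 : Fin 3) ≠ 2 by decide), coordArc_apply_ne (show (1 : Fin 3) ≠ 2 by decide)]
    simp

/-- CLOSURE: from a germ of the class, every move with ALL WEIGHTS POSITIVE (a weighted point
blow-up after an arbitrary formal coordinate change) has an exceptional point off the vertex with
a factorised successor `g` (`s ∤ g`) again in the class. [folklore] -/
theorem arcSingular_successor {n : ℕ} {f : MvPowerSeries (Fin n) k} (hf : ArcSingular f)
    (θ : Fin n → MvPowerSeries (Fin n) k) (w : Fin n → ℕ)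
    (hθ0 : ∀ i, MvPowerSeries.constantCoeff (θ i) = 0)
    (hdet : IsUnit (Matrix.det (Matrix.of fun i j => MvPowerSeries.coeff (Finsupp.single j 1) (θ i))))
    (hw : ∀ i, 0 < w i) :
    ∃ (c : Fin n → k), (∃ i, 0 < w i ∧ c i ≠ 0) ∧ ∃ (a : ℕ) (g : MvPowerSeries (Fin (n + 1)) k),
      MvPowerSeries.subst (fun i : Fin n => if 0 < w i then
          MvPowerSeries.X (0 : Fin (n + 1)) ^ (w i) * (MvPowerSeries.C (c i) + MvPowerSeries.X i.succ)
          else MvPowerSeries.X i.succ) (MvPowerSeries.subst θ f) = MvPowerSeries.X 0 ^ a * g ∧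
      ¬ MvPowerSeries.X 0 ∣ g ∧ ArcSingular g := by
  classical
  obtain ⟨hf0, hf2, Γ, hΓc, ⟨i₁, hi₁⟩, hΓf, hΓpd⟩ := hf
  obtain ⟨ψ, hψ0, hcomp, -⟩ := exists_comp_inverse hθ0 hdet
  set f' := MvPowerSeries.subst θ f with hf'
  have hf'0 : f' ≠ 0 := subst_ne_zero_of_isUnit_det hθ0 hdet hf0
  -- transported arc
  set Γ' : Fin n → PowerSeries k := fun i => MvPowerSeries.subst Γ (ψ i) with hΓ'
  have hΓ'c : ∀ i, PowerSeries.constantCoeff (Γ' i) = 0 := constantCoeff_subst_arc_zero hψ0 Γ hΓc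
  have hΓ'ne : ∃ i, 0 < w i ∧ Γ' i ≠ 0 := by
    by_contra hcon
    push Not at hcon
    have hall : ∀ i, Γ' i = 0 := fun i => hcon i (hw i)
    apply hi₁
    -- Γ i₁ = θ_{i₁}(Γ') = θ_{i₁}(0) = 0
    have hasψ := MvPowerSeries.hasSubst_of_constantCoeff_zero hψ0
    have hasΓ : MvPowerSeries.HasSubst Γ := MvPowerSeries.hasSubst_of_constantCoeff_zero hΓc
    have h1 : (MvPowerSeries.subst Γ (MvPowerSeries.subst ψ (θ i₁)) : PowerSeries k) = Γ i₁ := by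
      rw [hcomp i₁, MvPowerSeries.subst_X hasΓ]
    rw [← h1, MvPowerSeries.subst_comp_subst_apply hasψ hasΓ]
    have : (fun i => MvPowerSeries.subst Γ (ψ i)) = (0 : Fin n → PowerSeries k) := by
      funext i; exact hall i
    rw [this]
    exact MvPowerSeries.subst_zero_of_constantCoeff_zero (hθ0 i₁)
  have hΓ'f : (MvPowerSeries.subst Γ' f' : PowerSeries k) = 0 := by
    rw [hΓ', hf', subst_arc_comp hθ0 hψ0 hcomp Γ hΓc, hΓf]
  have hΓ'pd : ∀ m, (MvPowerSeries.subst Γ' (pd m f') : PowerSeries k) = 0 := fun m => by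
    rw [hΓ', hf']; exact subst_arc_pd_comp hθ0 hψ0 hcomp Γ hΓc f hΓpd m
  -- lift
  obtain ⟨W, hW, c, Λ, hc, hoff, hΛc, hs, hchart⟩ := exists_arc_lift w Γ' hΓ'c hΓ'ne
  have hasΛ : MvPowerSeries.HasSubst Λ := MvPowerSeries.hasSubst_of_constantCoeff_zero hΛc
  have hasΓ' : MvPowerSeries.HasSubst Γ' := MvPowerSeries.hasSubst_of_constantCoeff_zero hΓ'c
  have hasC : MvPowerSeries.HasSubst (chart w c) := hasSubst_chart w c hc
  have key : ∀ φ : MvPowerSeries (Fin n) k, (MvPowerSeries.subst Γ' φ : PowerSeries k) = 0 →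
      (MvPowerSeries.subst Λ (MvPowerSeries.subst (chart w c) φ) : PowerSeries k) = 0 := by
    intro φ hφ
    rw [MvPowerSeries.subst_comp_subst_apply hasC hasΛ]
    have : (fun i => MvPowerSeries.subst Λ (chart w c i)) = fun i => MvPowerSeries.expand W hW (Γ' i) := by
      funext i; exact hchart i
    rw [this, ← MvPowerSeries.expand_subst W hW hasΓ']
    change MvPowerSeries.expand W hW (MvPowerSeries.subst Γ' φ) = 0
    rw [hφ, map_zero]
  -- factorise the transform
  have hF : MvPowerSeries.subst (chart w c) f' ≠ 0 := subst_chart_ne_zero w c hc hf'0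
  obtain ⟨a, g, hfac, hg⟩ := CobordantVertexChart.exists_eq_X_pow_mul_not_dvd hF
  have h0 : MvPowerSeries.subst Λ (MvPowerSeries.subst (chart w c) f') = 0 := key f' hΓ'f
  have h1 : ∀ J, MvPowerSeries.subst Λ (pd J (MvPowerSeries.subst (chart w c) f')) = 0 := by
    intro J
    rw [pd_subst (chart w c) (constantCoeff_chart w c hc) f' J, ← MvPowerSeries.coe_substAlgHom hasΛ, map_sum]
    refine Finset.sum_eq_zero fun m _ => ?_
    rw [map_mul, MvPowerSeries.coe_substAlgHom hasΛ, key (pd m f') (hΓ'pd m), zero_mul]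
  obtain ⟨hgΛ, hgpd⟩ := arc_persists hfac Λ hΛc hs h0 h1
  have hsing := singular_of_arc hfac Λ hΛc hs h0 h1
  refine ⟨c, hoff, a, g, ?_, hg, ?_⟩
  · rw [cruxChart_eq_chart_of_convention w c hc]; exact hfac
  · exact ⟨fun h => hg (h ▸ dvd_zero _), hsing, Λ, hΛc, ⟨0, hs⟩, hgΛ, hgpd⟩

/-- WEIGHTED POINT BLOW-UPS ALONE CANNOT WIN (every field): there is no rank function for the
crux's game restricted to moves with ALL weights positive (centre = the origin after an arbitrary
formal coordinate change).  The refuter keeps a germ carrying a singular arc forever, starting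
from the node cylinder `x₀x₁ ⊂ 𝔸³`. [folklore] -/
theorem pointCentres_game_lost (k : Type) [Field k] :
    ¬ ∃ ι : (n : ℕ) → MvPowerSeries (Fin n) k → Ordinal.{0}, ∀ (n : ℕ) (f : MvPowerSeries (Fin n) k), (f ≠ 0 ∧ MvPowerSeries.constantCoeff f = 0 ∧ ∀ i, MvPowerSeries.coeff (Finsupp.single i 1) f = 0) → ∃ (θ : Fin n → MvPowerSeries (Fin n) k) (w : Fin n → ℕ), (∀ i, MvPowerSeries.constantCoeff (θ i) = 0) ∧ IsUnit (Matrix.det (Matrix.of fun i j => MvPowerSeries.coeff (Finsupp.single j 1) (θ i))) ∧ (∀ i, 0 < w i) ∧ ∀ (c : Fin n → k), (∃ i, 0 < w i ∧ c i ≠ 0) → ∀ (a : ℕ) (g : MvPowerSeries (Fin (n + 1)) k), MvPowerSeries.subst (fun i : Fin n => if 0 < w i then MvPowerSeries.X (0 : Fin (n + 1)) ^ (w i) * (MvPowerSeries.C (c i) + MvPowerSeries.X i.succ) else MvPowerSeries.X i.succ) (MvPowerSeries.subst θ f) = MvPowerSeries.X (0 : Fin (n + 1)) ^ a * g → ¬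 (MvPowerSeries.X (0 : Fin (n + 1)) ∣ g) → (MvPowerSeries.constantCoeff g = 0 ∧ ∀ j, MvPowerSeries.coeff (Finsupp.single j 1) g = 0) → ι (n + 1) g < ι n f := by
  classical
  rintro ⟨ι, H⟩
  let P : (Σ n, MvPowerSeries (Fin n) k) → Prop := fun x => ArcSingular x.2
  have hne : ∃ x, P x := ⟨⟨3, _⟩, arcSingular_node_cylinder⟩
  obtain ⟨x, hx, hmin⟩ := WellFounded.has_min
    (InvImage.wf (fun x : Σ n, MvPowerSeries (Fin n) k => ι x.1 x.2) Ordinal.lt_wf) {x | P x} hne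
  obtain ⟨n, f⟩ := x
  have hxP : ArcSingular f := hx
  obtain ⟨θ, w, hθ0, hdet, hw, Hc⟩ := H n f ⟨hxP.1, hxP.2.1.1, hxP.2.1.2⟩
  obtain ⟨c, hoff, a, g, hfac, hg, hgP⟩ := arcSingular_successor hxP θ w hθ0 hdet hw
  have hlt := Hc c hoff a g hfac hg hgP.2.1
  exact hmin ⟨n + 1, g⟩ hgP hlt

end PointCentres


/-! ### Corollary for the prover: a one-move win needs a centre containing every singular arc -/

section OneMoveNecessary

open Literature.AlgebraicGeometry.Resolution.CobordantChart
  Literature.AlgebraicGeometry.Resolution.FormalCoordChange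
  Literature.AlgebraicGeometry.Resolution

variable {k : Type*} [Field k] {n : ℕ}

/-- NECESSARY CONDITION FOR A ONE-MOVE WIN.  If the move `(θ, w)` from `f` leaves NO singular
`s`-saturated successor at any exceptional point off the vertex (literal crux form), then every
arc `Γ` of the singular locus of `f` through the origin is carried by `θ⁻¹` INTO THE CENTRE:
all components of positive weight of `ψ ∘ Γ` vanish (`ψ` the compositional inverse of `θ`).
In words: the centre of a resolving weighted blow-up must contain all singular arcs. [folklore] -/
theorem centre_contains_singular_arcs_of_oneMoveWin (f : MvPowerSeries (Fin n) k)
    (θ ψ : Fin n → MvPowerSeries (Fin n) k) (w : Fin n → ℕ)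
    (hθ0 : ∀ i, MvPowerSeries.constantCoeff (θ i) = 0) (hψ0 : ∀ i, MvPowerSeries.constantCoeff (ψ i) = 0)
    (hcomp : ∀ s, MvPowerSeries.subst ψ (θ s) = MvPowerSeries.X s)
    (hwin : ∀ (c : Fin n → k), (∃ i, 0 < w i ∧ c i ≠ 0) → ∀ (a : ℕ) (g : MvPowerSeries (Fin (n + 1)) k),
      MvPowerSeries.subst (fun i : Fin n => if 0 < w i then
          MvPowerSeries.X (0 : Fin (n + 1)) ^ (w i) * (MvPowerSeries.C (c i) + MvPowerSeries.X i.succ)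
          else MvPowerSeries.X i.succ) (MvPowerSeries.subst θ f) = MvPowerSeries.X 0 ^ a * g →
      ¬ MvPowerSeries.X 0 ∣ g →
      ¬ (MvPowerSeries.constantCoeff g = 0 ∧ ∀ J, MvPowerSeries.coeff (Finsupp.single J 1) g = 0))
    (hf0 : MvPowerSeries.subst θ f ≠ 0)
    (Γ : Fin n → PowerSeries k) (hΓc : ∀ i, PowerSeries.constantCoeff (Γ i) = 0)
    (hΓf : (MvPowerSeries.subst Γ f : PowerSeries k) = 0)
    (hΓpd : ∀ m, (MvPowerSeries.subst Γ (pd m f) : PowerSeries k) = 0) :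
    ∀ i, 0 < w i → (MvPowerSeries.subst Γ (ψ i) : PowerSeries k) = 0 := by
  classical
  by_contra hcon
  push Not at hcon
  obtain ⟨i, hwi, hne⟩ := hcon
  set Γ' : Fin n → PowerSeries k := fun i => MvPowerSeries.subst Γ (ψ i) with hΓ'
  have hΓ'c : ∀ i, PowerSeries.constantCoeff (Γ' i) = 0 := constantCoeff_subst_arc_zero hψ0 Γ hΓc
  have hΓ'f : (MvPowerSeries.subst Γ' (MvPowerSeries.subst θ f) : PowerSeries k) = 0 := by
    rw [hΓ', subst_arc_comp hθ0 hψ0 hcomp Γ hΓc, hΓf]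
  have hΓ'pd : ∀ m, (MvPowerSeries.subst Γ' (pd m (MvPowerSeries.subst θ f)) : PowerSeries k) = 0 :=
    fun m => by rw [hΓ']; exact subst_arc_pd_comp hθ0 hψ0 hcomp Γ hΓc f hΓpd m
  obtain ⟨c, hc, hoff, hall⟩ :=
    exists_offVertex_singular_of_arc w (MvPowerSeries.subst θ f) Γ' hΓ'c ⟨i, hwi, hne⟩ hΓ'f hΓ'pd
  have hF : MvPowerSeries.subst (chart w c) (MvPowerSeries.subst θ f) ≠ 0 := subst_chart_ne_zero w c hc hf0
  obtain ⟨a, g, hfac, hg⟩ := CobordantVertexChart.exists_eq_X_pow_mul_not_dvd hF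
  have h := hwin c hoff a g (by rw [cruxChart_eq_chart_of_convention w c hc]; exact hfac) hg
  exact h (hall a g hfac)

end OneMoveNecessary


end Literature.AlgebraicGeometry.Resolution.CobordantArc
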